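import Literature.NumberTheory.LFunctions.MoebiusAutomaticTransducerReduction
import Literature.NumberTheory.LFunctions.AutomaticSequencePowTransducer5
import HarnessLib

/-!
# Müllner's theorem from Prop. 3.2 for automata with `d = k₀ = 1` (Prop. 3.3 after Prop. 2.25; proved)

Everything in this file is PROVED. It sharpens the reduction
`mullner_moebius_automatic_of_transducerEstimate` (`MoebiusAutomaticTransducerReduction.lean`,
Müllner's Prop. 3.3) by Müllner's Prop. 2.25 (`AutomaticSequencePowTransducer5.lean`): to prove the
named fact `mullner_moebius_automatic` (C. Müllner, *Automatic sequences fulfill the Sarnak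
conjecture*, Duke Math. J. 166 (2017), Thm. 1.2 for `ξ = a`) it suffices to establish the
transducer estimate `TransducerMoebiusEstimateSync K δ' M π l1 l2` (Prop. 3.2, regular
representation, synchronized residues) for the strongly connected base-`K` automata (`K ≥ 2`,
letters `≥ K` trivial) whose naturally induced transducer has

  `d(δ') = transducerPeriod K δ' = 1` and `k₀(δ') = transducerK0 hK δ' htriv = 1`

— exactly the class of automata for which §4 of the paper (Thm. 4.4 with the Fourier property
Thm. 4.5) is carried out.

* `transducerK0_pos` — `k₀(A) ≥ 1`;
* `isLittleO_moebiusSum_dfaoSeq_of_transducerEstimate_dk1` — one DFAO: pass to the base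
  `K = k^p`, `p = d(Â) k₀(Â)` for the digit-restricted automaton `Â` (`dfaoSeq_pow`), apply the
  component-wise reduction `isLittleO_moebiusSum_dfaoSeq_of_transducerEstimate'` in base `K`, and
  feed it the hypothesis on the final components of the power automaton, which have `d = k₀ = 1`
  (`transducerPeriod_sub_powK_eq_one`, `transducerK0_sub_powK_eq_one`);
* `mullner_moebius_automatic_of_transducerEstimate_dk1` — the named fact from the estimate for
  this class (kernel characterisation A–S 6.6.2 and the normalisation `δ(q₀,0) = q₀` as before).

## References
* C. Müllner, Duke Math. J. 166 (2017) = arXiv:1602.03042: Prop. 2.25, Prop. 3.2, Prop. 3.3.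
  [Mullner2017]
-/

noncomputable section

open Finset Filter Asymptotics
open scoped ArithmeticFunction.Moebius

namespace Literature.NumberTheory.LFunctions

/-- `k₀(A) ≥ 1` (an additive order in the finite group `ZMod d'`, `d' ≥ 1`). [folklore] -/
theorem transducerK0_pos {σ : Type*} [Fintype σ] [DecidableEq σ] {k : ℕ} (hk : 2 ≤ k)
    (δ : σ → ℕ → σ) (htriv : ∀ q d, k ≤ d → δ q d = q) : 0 < transducerK0 hk δ htriv := by
  have hd : 0 < transducerDPrime hk δ htriv := by
    have h1 : 0 < k ^ transducerPeriod k δ - 1 := by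
      have : 1 < k ^ transducerPeriod k δ :=
        Nat.one_lt_pow (transducerPeriod_pos (by omega) htriv).ne' (by omega)
      omega
    exact Nat.pos_of_dvd_of_pos (transducerDPrime_dvd hk δ htriv) h1 |>
      fun h => Nat.pos_of_ne_zero fun h0 => by
        have := transducerDPrime_dvd hk δ htriv; rw [h0, zero_dvd_iff] at this; omega
  haveI : NeZero (transducerDPrime hk δ htriv) := ⟨hd.ne'⟩
  rw [transducerK0]
  exact (isOfFinAddOrder_of_finite _).addOrderOf_pos

/-- **Prop. 3.3 after Prop. 2.25, for one DFAO**: if the transducer estimate holds for all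
strongly connected base-`K` automata with `d = k₀ = 1` (all `K ≥ 2`), then the sequence of any
finite DFAO with `δ(q₀, 0) = q₀`, read from the most significant digit in base `k ≥ 2`, is
orthogonal to `μ`. [cite: Mullner2017, Prop. 3.3 / Prop. 2.25] -/
theorem isLittleO_moebiusSum_dfaoSeq_of_transducerEstimate_dk1 {σ : Type} [Fintype σ]
    [DecidableEq σ] {k : ℕ} (hk : 2 ≤ k) (δ₀ : σ → ℕ → σ) (q₀ : σ) (τ : σ → ℂ) (h0 : δ₀ q₀ 0 = q₀)
    (H : ∀ (K : ℕ) (hK : 2 ≤ K) (σ' : Type) [Fintype σ'] [DecidableEq σ'] (δ' : σ' → ℕ → σ'),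
      IsStronglyConnected δ' → ∀ (htriv' : ∀ q d, K ≤ d → δ' q d = q),
      transducerPeriod K δ' = 1 → transducerK0 hK δ' htriv' = 1 →
      ∀ (M : MinImage δ') (π : Equiv.Perm (Fin (minRank δ'))) (l1 l2 : ℕ),
        TransducerMoebiusEstimateSync K δ' M π l1 l2) :
    moebiusSum (dfaoSeq k δ₀ q₀ τ) =o[atTop] fun N : ℕ => (N : ℝ) := by
  have hk0 : 0 < k := by omega
  have htriv : ∀ q d, k ≤ d → digitRestrict k δ₀ q d = q := digitRestrict_trivial k δ₀
  have h0' : digitRestrict k δ₀ q₀ 0 = q₀ := by rw [digitRestrict_of_lt δ₀ q₀ hk0]; exact h0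
  -- the exponent `p = d(Â) k₀(Â)` and the base `K = k^p`
  have hp0 : 0 < transducerPeriod k (digitRestrict k δ₀) * transducerK0 hk (digitRestrict k δ₀) htriv :=
    Nat.mul_pos (transducerPeriod_pos hk0 htriv) (transducerK0_pos hk _ htriv)
  obtain ⟨p, hp, hpdef⟩ : ∃ p : ℕ, 0 < p ∧
      p = transducerPeriod k (digitRestrict k δ₀) * transducerK0 hk (digitRestrict k δ₀) htriv :=
    ⟨_, hp0, rfl⟩
  have hK : 2 ≤ k ^ p := by
    calc 2 ≤ k := hk
      _ = k ^ 1 := (pow_one k).symm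
      _ ≤ k ^ p := Nat.pow_le_pow_right hk0 hp
  -- the same sequence in base `K`
  rw [← dfaoSeq_digitRestrict hk δ₀ q₀ τ, ← dfaoSeq_pow hk hp h0' τ]
  refine isLittleO_moebiusSum_dfaoSeq_of_transducerEstimate' hK (powδ k p (digitRestrict k δ₀)) q₀ τ
    (powδ_zero h0') fun p' hp' M π l1 l2 => ?_
  have hdp : transducerPeriod k (digitRestrict k δ₀) ∣ p := hpdef ▸ dvd_mul_right _ _
  have hkp : transducerPeriod k (digitRestrict k δ₀) * transducerK0 hk (digitRestrict k δ₀) htriv ∣ p :=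
    hpdef ▸ dvd_rfl
  exact H (k ^ p) hK _ _ (isStronglyConnected_restrict_reach hp')
    (sub_powK_trivial k p (digitRestrict k δ₀) _ _)
    (transducerPeriod_sub_powK_eq_one hk hp (digitRestrict k δ₀) htriv hdp _ _)
    (transducerK0_sub_powK_eq_one hk hp (digitRestrict k δ₀) htriv hK hdp hkp _ _) M π l1 l2

/-- **Müllner's Thm. 1.2 (`ξ = a`) from Prop. 3.2 for automata with `d = k₀ = 1`**: if every
strongly connected base-`K` automaton (`K ≥ 2`, letters `≥ K` trivial) whose naturally induced
transducer has period `d = 1` and `k₀ = 1` satisfies the transducer estimate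
`TransducerMoebiusEstimateSync` (Prop. 3.2, regular representation, synchronized residues), then
`mullner_moebius_automatic` holds. [cite: Mullner2017, Prop. 3.3 / Prop. 2.25 / Thm. 1.2] -/
theorem mullner_moebius_automatic_of_transducerEstimate_dk1
    (H : ∀ (K : ℕ) (hK : 2 ≤ K) (σ' : Type) [Fintype σ'] [DecidableEq σ'] (δ' : σ' → ℕ → σ'),
      IsStronglyConnected δ' → ∀ (htriv' : ∀ q d, K ≤ d → δ' q d = q),
      transducerPeriod K δ' = 1 → transducerK0 hK δ' htriv' = 1 →
      ∀ (M : MinImage δ') (π : Equiv.Perm (Fin (minRank δ'))) (l1 l2 : ℕ),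
        TransducerMoebiusEstimateSync K δ' M π l1 l2) :
    mullner_moebius_automatic := by
  classical
  rw [mullner_moebius_automatic_iff_isLittleO]
  intro k hk a ha
  obtain ⟨σ, _, δ, q₀, τ, rfl⟩ := ha.exists_dfaoSeq hk
  rw [← dfaoSeq_optionLift k δ q₀ τ]
  exact isLittleO_moebiusSum_dfaoSeq_of_transducerEstimate_dk1 hk (optionLiftδ δ q₀) none
    (optionLiftτ τ q₀) (optionLiftδ_none_zero δ q₀) H

end Literature.NumberTheory.LFunctions
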